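/-
Copyright: the b2b-balaban T⁴-continuum CRUX team, row NE7b OWNER lineage `t4-ne7b-p1` (gen 106). Project licence.
-/
import Literature.Probability.Moments.BrascampLiebVarianceViaPrekopaLeindler

/-!
# THE CONVEXITY ROAD FOR THE HESSIAN-SMALL REMAINDER: one Jensen step + the Brascamp–Lieb variance inequality (IN THE TREE) bound the
# sacrificed exponential moment by the TILTED second moments — `log(∫e^{−V} ∕ ∫e^{−(V+g)}) ≤ Σ_k q_k(‖u_k‖²∕λ + m_k²)` for `g = Σ_k q_k⟪u_k,·⟫²`
# and `V` `λ`-uniformly convex (row NE7b, node U5c; residual (R2′), family (2) of the refuter's price map; kernel theorems)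

Cell `pub-balaban`, sub-cell `t4`, spine estimate NE7b (`T4WeightBudget.RelWeightBound`; the cell's OWN estimate — NOT PRINTED in
[Bałaban 1983–89], NOT PROVED).  Crux-route work under `Spine/NE7b/` by the row's OWNER; NOTHING of Bałaban's is named or asserted;
no `T4Continuum/Support` leaf typed; no `def`; zero `sorry`.

WHY.  The owner's sandwich (`…NE7b.LocalPerturbationSandwich`, `…StabilityWindowSandwich`) prices a near remainder `e^{−V₁}` of the
one-step density BY VALUE (`e^{2v}`, `|V₁| ≤ v`).  The refuter's price map (PRICING-NE7b v70∕v71, F388 κ-ne7bref-g67-3 (a), κ-g67-5)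
located the family for which the by-value road is the expensive fallback: the ANHARMONIC Taylor remainder of the main action on the
small-field window — LARGE by value at the window's edge, but with a SMALL HESSIAN, so that the full exponent
`W = zᵀSz + V_β − zᵀQz` stays UNIFORMLY CONVEX; and idea-1 g60's memo `t4/ideate/NE7b/checks-g60/LOGCONCAVE-DOMINATION-R2-idea1-g60.md`
(T-60) proposed the convexity road: ONE Jensen step plus the Brascamp–Lieb variance inequality, which the tree PROVES
(`Literature.Probability.Moments.variance_tilted_le`, Brascamp–Lieb 1976 Thm 4.1 via Prékopa–Leindler).  THIS FILE types that road
as kernel theorems, VALUE-FREE: for `V` `λ`-uniformly convex (first-order form, verbatim the tree's letter) and a sacrificed form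
`g = Σ_k q_k⟪u_k, ·⟫²` (`q_k ≥ 0`; any positive-semidefinite quadratic form is of this shape by the spectral theorem),
**`∫e^{−V} ≤ exp(Σ_k q_k·(λ⁻¹‖u_k‖² + m_k²)) · ∫e^{−(V+g)}`** with `m_k = ∫⟪u_k, x⟫ dν_V` the means under the TILTED probability
measure `ν_V = e^{−V}dx ∕ ∫e^{−V}` — i.e. with `W := V + g` the full exponent and `g` the sacrificed part,
`log(∫e^{g}e^{−W} ∕ ∫e^{−W}) ≤ tr(Q)∕λ + mᵀQm ≤ r·q₀∕λ + mᵀQm` (T-60a′): RANK-extensive, THRESHOLD-free, and insensitive to the VALUE of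
the non-quadratic part of `V` — only its convexity modulus enters.  What is displayed, not supplied: the tilted means `m_k` (the
(R1″)-class letter of this road — the induced ∕ tilted mean energy `mᵀQm`), the uniform convexity of `V` ON THE WINDOW (the refuter's
Δ4: print's small-field conditions as a convex restriction, or the window's indicator riding as an even log-concave factor — leaf-01
g79's class), integrabilities.

WHAT IS PROVED ([folklore]; the tangent line of `exp`, Bochner linearity ∕ monotonicity, the tree's `variance_tilted_le` BY NAME):
* §1 **`integral_mul_exp_le_exp_tiltedMean`** (ANY measure; ONE JENSEN STEP without the convexity API: `ρ ≥ 0`,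
  `∫ρe^{g} ≤ exp((∫g·ρe^{g}) ∕ ∫ρe^{g}) · ∫ρ` — from `e^{−t} ≥ e^{−c}(1 + c − t)` integrated against `ρe^{g}` with `c` the tilted
  mean of `g`), `exp_neg_tangent`.
* §2 **`sq_moment_inner_le`** (on `EuclideanSpace ℝ (Fin n)`: under the `λ`-uniformly log-concave tilt, `∫⟪u,x⟫² dν_V ≤ λ⁻¹‖u‖² +
  (∫⟪u,x⟫dν_V)²` — `variance_tilted_le` at the linear test function `⟪u, ·⟫`, whose derivative is `innerSL ℝ u` of norm `‖u‖`).
* §3 **`tiltedMean_qf_le`** (`∫ Σ_k q_k⟪u_k,x⟫² dν_V ≤ Σ_k q_k(λ⁻¹‖u_k‖² + m_k²)`) and the assembled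
  **`exp_moment_le_of_uniformlyConvex`** (the display above).
* §4 **`exp_moment_le_of_uniformlyConvex_window`** (the same ON A WINDOW `K` carrying the fraction `1−η` of the tilted mass — the
  refuter's Δ4, disposition (a) «extension + mass fraction»: `∫_K e^{−V} ≤ exp((Σ_k q_k(λ⁻¹‖u_k‖² + m_k²))∕(1−η))·∫_K e^{−(V+g)}`; the
  Jensen step runs under the windowed weight, the windowed tilted mean of `g ≥ 0` is at most the unwindowed one over the mass fraction).

NOT HERE (honest): uniform convexity of Bałaban's small-field exponents on their windows (Δ4) and the tilted-mean energies ((R1″)-class)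
— (A1c) readings; the junction to the coupled-block letters of `…GaussianFibrewiseDecoupling` (coordinates `Fin n → ℝ` vs
`EuclideanSpace`: a transport, not done here); anything of Bałaban's.  NE7b NOT PRINTED ∕ NOT PROVED; spine PROVED 0∕9; rung (B)+1 on a
FINITE torus — NOT infinite volume, NOT the mass gap, NOT Clay.
HONEST DEPENDENCY: continuum YM on T⁴ ⇐ BetaPertH ∧ nine spine estimates (0/9 proved); BetaPertH ⇐ (D1) ∧ (D4) ∧ CAP+tail.
-/

set_option autoImplicit false

noncomputable section

open MeasureTheory Real Finset
open scoped RealInnerProductSpace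
open Literature.Probability.Moments

namespace Summit.QuantumFields.BalabanUV.T4Continuum.NE7b.ConvexTiltMoment

/-! ## §1 One Jensen step, any measure: the exponential moment is at most `exp` of the TILTED mean -/

section Jensen

variable {X : Type*} [MeasurableSpace X] (μ : Measure X)

/-- The tangent line of `t ↦ e^{−t}` at `c`: `e^{−c}·(1 + c − t) ≤ e^{−t}`. [folklore] -/
theorem exp_neg_tangent (c t : ℝ) : exp (-c) * (1 + c - t) ≤ exp (-t) := by
  have h := add_one_le_exp (c - t)
  have e : exp (-t) = exp (-c) * exp (c - t) := by rw [← exp_add]; ring_nf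
  rw [e]
  exact mul_le_mul_of_nonneg_left (by linarith) (exp_pos _).le

/-- **ONE JENSEN STEP** (any measure, no convexity API): for `ρ ≥ 0` integrable with `ρ·e^{g}` and `g·ρ·e^{g}` integrable and
`∫ρe^{g} > 0`, `∫ρ·e^{g} ≤ exp(c)·∫ρ` with `c = (∫g·ρe^{g}) ∕ ∫ρe^{g}` the mean of `g` under the TILTED weight `ρe^{g}` — Jensen for
`e^{−t}` under the tilted probability, proved from the tangent line at `c`. [folklore] -/
theorem integral_mul_exp_le_exp_tiltedMean {ρ g : X → ℝ} (hρ : ∀ x, 0 ≤ ρ x) (hρi : Integrable ρ μ)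
    (hZ : Integrable (fun x => ρ x * exp (g x)) μ) (hg : Integrable (fun x => g x * (ρ x * exp (g x))) μ)
    (hpos : 0 < ∫ x, ρ x * exp (g x) ∂μ) :
    ∫ x, ρ x * exp (g x) ∂μ ≤
      exp ((∫ x, g x * (ρ x * exp (g x)) ∂μ) / ∫ x, ρ x * exp (g x) ∂μ) * ∫ x, ρ x ∂μ := by
  set Z := ∫ x, ρ x * exp (g x) ∂μ with hZdef
  set c := (∫ x, g x * (ρ x * exp (g x)) ∂μ) / Z with hcdef
  have hpt : ∀ x, exp (-c) * ((1 + c) * (ρ x * exp (g x)) - g x * (ρ x * exp (g x))) ≤ ρ x := by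
    intro x
    have h1 := mul_le_mul_of_nonneg_right (exp_neg_tangent c (g x)) (mul_nonneg (hρ x) (exp_pos (g x)).le)
    have h2 : exp (-g x) * (ρ x * exp (g x)) = ρ x := by
      rw [mul_left_comm, ← exp_add, neg_add_cancel, exp_zero, mul_one]
    calc exp (-c) * ((1 + c) * (ρ x * exp (g x)) - g x * (ρ x * exp (g x)))
        = exp (-c) * (1 + c - g x) * (ρ x * exp (g x)) := by ring
      _ ≤ exp (-g x) * (ρ x * exp (g x)) := h1
      _ = ρ x := h2
  have hint : Integrable (fun x => exp (-c) * ((1 + c) * (ρ x * exp (g x)) - g x * (ρ x * exp (g x)))) μ :=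
    ((hZ.const_mul _).sub hg).const_mul _
  have hle := integral_mono hint hρi hpt
  rw [integral_const_mul, integral_sub (hZ.const_mul _) hg, integral_const_mul] at hle
  have hcZ : (∫ x, g x * (ρ x * exp (g x)) ∂μ) = c * Z := by
    rw [hcdef, div_mul_cancel₀ _ hpos.ne']
  rw [hcZ] at hle
  have e3 : exp (-c) * ((1 + c) * Z - c * Z) = exp (-c) * Z := by ring
  rw [e3] at hle
  calc Z = exp c * (exp (-c) * Z) := by rw [← mul_assoc, ← exp_add, add_neg_cancel, exp_zero, one_mul]
    _ ≤ exp c * ∫ x, ρ x ∂μ := mul_le_mul_of_nonneg_left hle (exp_pos _).le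

end Jensen

/-! ## §2 Second moments of linear functionals under a uniformly log-concave tilt (Brascamp–Lieb, by name) -/

section Euclidean

variable {n : ℕ}

/-- **SECOND MOMENT OF A LINEAR FUNCTIONAL UNDER A `λ`-UNIFORMLY LOG-CONCAVE TILT**: `∫⟪u,x⟫² dν_V ≤ λ⁻¹‖u‖² + (∫⟪u,x⟫ dν_V)²`,
`ν_V = e^{−V}dx ∕ ∫e^{−V}` on `EuclideanSpace ℝ (Fin n)` — the tree's Brascamp–Lieb variance inequality
`Literature.Probability.Moments.variance_tilted_le` at the test function `⟪u, ·⟫` (derivative `innerSL ℝ u`, of norm `‖u‖`);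
integrability of `⟪u,·⟫` and `⟪u,·⟫²` under the tilt displayed. [folklore] -/
theorem sq_moment_inner_le {V : EuclideanSpace ℝ (Fin n) → ℝ} {lam : ℝ} (hlam : 0 < lam) (hVc : Continuous V)
    (hV : ∀ x y : EuclideanSpace ℝ (Fin n), V x + ⟪gradient V x, y - x⟫ + lam / 2 * ‖y - x‖ ^ 2 ≤ V y)
    (hZ : Integrable fun x => exp (-V x)) (u : EuclideanSpace ℝ (Fin n))
    (h1 : Integrable (fun x => ⟪u, x⟫) (volume.tilted fun x => -V x))
    (h2 : Integrable (fun x => ⟪u, x⟫ ^ 2) (volume.tilted fun x => -V x)) :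
    ∫ x, ⟪u, x⟫ ^ 2 ∂(volume.tilted fun x => -V x) ≤
      lam⁻¹ * ‖u‖ ^ 2 + (∫ x, ⟪u, x⟫ ∂(volume.tilted fun x => -V x)) ^ 2 := by
  have ef : (fun x : EuclideanSpace ℝ (Fin n) => ⟪u, x⟫) = ⇑(innerSL ℝ u) := by
    funext x; rw [innerSL_apply_apply]
  have hf : ContDiff ℝ 1 (fun x : EuclideanSpace ℝ (Fin n) => ⟪u, x⟫) := by
    rw [ef]; exact (innerSL ℝ u).contDiff
  have hD : ∀ x : EuclideanSpace ℝ (Fin n), fderiv ℝ (fun x : EuclideanSpace ℝ (Fin n) => ⟪u, x⟫) x = innerSL ℝ u :=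
    fun x => by rw [ef]; exact (innerSL ℝ u).fderiv
  haveI : IsProbabilityMeasure (volume.tilted fun x : EuclideanSpace ℝ (Fin n) => -V x) :=
    isProbabilityMeasure_tilted hZ
  have h3 : Integrable (fun x => ‖fderiv ℝ (fun x : EuclideanSpace ℝ (Fin n) => ⟪u, x⟫) x‖ ^ 2)
      (volume.tilted fun x => -V x) := by
    simp_rw [hD, innerSL_apply_norm]
    exact integrable_const _
  have hvar := variance_tilted_le hlam hVc hV hZ hf h1 h2 h3
  simp_rw [hD, innerSL_apply_norm, integral_const, smul_eq_mul] at hvar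
  simp only [probReal_univ, one_mul] at hvar
  linarith

/-! ## §3 The tilted mean of the sacrificed form, and the assembled bound -/

/-- **THE TILTED MEAN OF A SUM OF SQUARES OF LINEAR FUNCTIONALS**: `∫ Σ_k q_k⟪u_k,x⟫² dν_V ≤ Σ_k q_k·(λ⁻¹‖u_k‖² + m_k²)` with
`m_k = ∫⟪u_k,x⟫ dν_V`, for `q_k ≥ 0` (`tr(Q)∕λ + mᵀQm` for the form `Q = Σ_k q_k u_k u_kᵀ`). [folklore] -/
theorem tiltedMean_qf_le {V : EuclideanSpace ℝ (Fin n) → ℝ} {lam : ℝ} {r : ℕ} (hlam : 0 < lam) (hVc : Continuous V)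
    (hV : ∀ x y : EuclideanSpace ℝ (Fin n), V x + ⟪gradient V x, y - x⟫ + lam / 2 * ‖y - x‖ ^ 2 ≤ V y)
    (hZ : Integrable fun x => exp (-V x)) (q : Fin r → ℝ) (hq : ∀ k, 0 ≤ q k) (u : Fin r → EuclideanSpace ℝ (Fin n))
    (h1 : ∀ k, Integrable (fun x => ⟪u k, x⟫) (volume.tilted fun x => -V x))
    (h2 : ∀ k, Integrable (fun x => ⟪u k, x⟫ ^ 2) (volume.tilted fun x => -V x)) :
    ∫ x, ∑ k, q k * ⟪u k, x⟫ ^ 2 ∂(volume.tilted fun x => -V x) ≤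
      ∑ k, q k * (lam⁻¹ * ‖u k‖ ^ 2 + (∫ x, ⟪u k, x⟫ ∂(volume.tilted fun x => -V x)) ^ 2) := by
  rw [integral_finsetSum _ fun k _ => (h2 k).const_mul (q k)]
  refine Finset.sum_le_sum fun k _ => ?_
  rw [integral_const_mul]
  exact mul_le_mul_of_nonneg_left (sq_moment_inner_le hlam hVc hV hZ (u k) (h1 k) (h2 k)) (hq k)

/-- **THE CONVEXITY ROAD, ASSEMBLED (T-60a′ as a theorem).**  For `V` continuous and `λ`-uniformly convex in the first-order sense
(`V x + ⟪∇V x, y − x⟫ + (λ∕2)‖y − x‖² ≤ V y`), `e^{−V}` integrable, and a sacrificed form `g = Σ_k q_k⟪u_k, ·⟫²` with `q_k ≥ 0` whose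
linear functionals have first and second moments under the tilt `ν_V = e^{−V}dx ∕ ∫e^{−V}`:
`∫e^{−V} ≤ exp(Σ_k q_k·(λ⁻¹‖u_k‖² + m_k²)) · ∫e^{−(V + g)}`, `m_k = ∫⟪u_k,x⟫ dν_V`.  With `W := V + g`: the exponential moment of the
sacrificed form under `e^{−W}` is at most `exp(tr(Q)∕λ + mᵀQm)` — value-free in the non-quadratic part of `W`. [folklore] -/
theorem exp_moment_le_of_uniformlyConvex {V : EuclideanSpace ℝ (Fin n) → ℝ} {lam : ℝ} {r : ℕ} (hlam : 0 < lam)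
    (hVc : Continuous V)
    (hV : ∀ x y : EuclideanSpace ℝ (Fin n), V x + ⟪gradient V x, y - x⟫ + lam / 2 * ‖y - x‖ ^ 2 ≤ V y)
    (hZ : Integrable fun x => exp (-V x)) (q : Fin r → ℝ) (hq : ∀ k, 0 ≤ q k) (u : Fin r → EuclideanSpace ℝ (Fin n))
    (h1 : ∀ k, Integrable (fun x => ⟪u k, x⟫) (volume.tilted fun x => -V x))
    (h2 : ∀ k, Integrable (fun x => ⟪u k, x⟫ ^ 2) (volume.tilted fun x => -V x)) :
    ∫ x, exp (-V x) ≤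
      exp (∑ k, q k * (lam⁻¹ * ‖u k‖ ^ 2 + (∫ x, ⟪u k, x⟫ ∂(volume.tilted fun x => -V x)) ^ 2)) *
        ∫ x, exp (-(V x + ∑ k, q k * ⟪u k, x⟫ ^ 2)) := by
  -- the sacrificed form `g`, non-negative and continuous
  have hg0 : ∀ x : EuclideanSpace ℝ (Fin n), 0 ≤ ∑ k, q k * ⟪u k, x⟫ ^ 2 :=
    fun x => Finset.sum_nonneg fun k _ => mul_nonneg (hq k) (sq_nonneg _)
  have hgc : Continuous fun x : EuclideanSpace ℝ (Fin n) => ∑ k, q k * ⟪u k, x⟫ ^ 2 :=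
    continuous_finsetSum _ fun k _ => continuous_const.mul ((continuous_const.inner continuous_id).pow 2)
  have eρ : ∀ x : EuclideanSpace ℝ (Fin n),
      exp (-(V x + ∑ k, q k * ⟪u k, x⟫ ^ 2)) * exp (∑ k, q k * ⟪u k, x⟫ ^ 2) = exp (-V x) := fun x => by
    rw [← exp_add]; ring_nf
  -- integrabilities for the Jensen step (ρ = e^{−(V+g)})
  have hρi : Integrable fun x : EuclideanSpace ℝ (Fin n) => exp (-(V x + ∑ k, q k * ⟪u k, x⟫ ^ 2)) :=
    hZ.mono' (hVc.add hgc).neg.rexp.aestronglyMeasurable (ae_of_all _ fun x => by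
      rw [Real.norm_of_nonneg (exp_pos _).le]
      exact exp_le_exp.2 (by linarith [hg0 x]))
  have hZ' : Integrable fun x : EuclideanSpace ℝ (Fin n) =>
      exp (-(V x + ∑ k, q k * ⟪u k, x⟫ ^ 2)) * exp (∑ k, q k * ⟪u k, x⟫ ^ 2) := by
    simp_rw [eρ]; exact hZ
  have h2v : ∀ k, Integrable (fun x : EuclideanSpace ℝ (Fin n) => exp (-V x) * ⟪u k, x⟫ ^ 2) := fun k => by
    have := (integrable_tilted_iff hZ _).1 (h2 k)
    simpa only [smul_eq_mul] using this
  have hgi : Integrable fun x : EuclideanSpace ℝ (Fin n) =>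
      (∑ k, q k * ⟪u k, x⟫ ^ 2) * (exp (-(V x + ∑ k, q k * ⟪u k, x⟫ ^ 2)) * exp (∑ k, q k * ⟪u k, x⟫ ^ 2)) := by
    simp_rw [eρ]
    have hsum := integrable_finsetSum Finset.univ fun k _ => (h2v k).const_mul (q k)
    refine hsum.congr (ae_of_all _ fun x => ?_)
    simp only [Finset.sum_mul]
    exact Finset.sum_congr rfl fun k _ => by ring
  have hpos : 0 < ∫ x : EuclideanSpace ℝ (Fin n),
      exp (-(V x + ∑ k, q k * ⟪u k, x⟫ ^ 2)) * exp (∑ k, q k * ⟪u k, x⟫ ^ 2) := by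
    simp_rw [eρ]; exact integral_exp_pos hZ
  have key := integral_mul_exp_le_exp_tiltedMean volume (fun x => (exp_pos _).le) hρi hZ' hgi hpos
  simp_rw [eρ] at key
  refine key.trans (mul_le_mul_of_nonneg_right (exp_le_exp.2 ?_) (integral_nonneg fun x => (exp_pos _).le))
  -- the tilted mean of `g`
  have htilt : (∫ x : EuclideanSpace ℝ (Fin n), (∑ k, q k * ⟪u k, x⟫ ^ 2) * exp (-V x)) / ∫ x, exp (-V x) =
      ∫ x, ∑ k, q k * ⟪u k, x⟫ ^ 2 ∂(volume.tilted fun x => -V x) := by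
    rw [integral_tilted, ← integral_div]
    refine integral_congr_ae (ae_of_all _ fun x => ?_)
    simp only [smul_eq_mul]
    ring
  rw [htilt]
  exact tiltedMean_qf_le hlam hVc hV hZ q hq u h1 h2

/-! ## §4 The same ON A WINDOW carrying mass (Δ4, disposition (a): extension + mass fraction) -/

/-- **THE CONVEXITY ROAD ON A WINDOW.**  Same data as `exp_moment_le_of_uniformlyConvex` (`V` defined and `λ`-uniformly convex on the
WHOLE space — an EXTENSION off the window is the instance's choice and changes nothing inside it), and a measurable window `K` carrying
the fraction `1 − η` (`η < 1`) of the tilted mass, `(1−η)·∫e^{−V} ≤ ∫_K e^{−V}`.  Then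
`∫_K e^{−V} ≤ exp((Σ_k q_k·(λ⁻¹‖u_k‖² + m_k²)) ∕ (1−η)) · ∫_K e^{−(V+g)}`: the Jensen step is taken under the WINDOWED tilt (any
`ρ ≥ 0` is allowed there), and the windowed tilted mean of the non-negative `g` is at most the unwindowed one divided by the mass
fraction.  The moments `m_k` and the convexity refer to the extension; the window's mass fraction is a displayed (R1″)-class letter
(Chernoff ∕ leaf-01's `logConcaveTail_le` in the even class). [folklore] -/
theorem exp_moment_le_of_uniformlyConvex_window {V : EuclideanSpace ℝ (Fin n) → ℝ} {lam η : ℝ} {r : ℕ} (hlam : 0 < lam)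
    (hVc : Continuous V)
    (hV : ∀ x y : EuclideanSpace ℝ (Fin n), V x + ⟪gradient V x, y - x⟫ + lam / 2 * ‖y - x‖ ^ 2 ≤ V y)
    (hZ : Integrable fun x => exp (-V x)) (q : Fin r → ℝ) (hq : ∀ k, 0 ≤ q k) (u : Fin r → EuclideanSpace ℝ (Fin n))
    (h1 : ∀ k, Integrable (fun x => ⟪u k, x⟫) (volume.tilted fun x => -V x))
    (h2 : ∀ k, Integrable (fun x => ⟪u k, x⟫ ^ 2) (volume.tilted fun x => -V x))
    (K : Set (EuclideanSpace ℝ (Fin n))) (hη : η < 1)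
    (hmass : (1 - η) * ∫ x, exp (-V x) ≤ ∫ x in K, exp (-V x)) :
    ∫ x in K, exp (-V x) ≤
      exp ((∑ k, q k * (lam⁻¹ * ‖u k‖ ^ 2 + (∫ x, ⟪u k, x⟫ ∂(volume.tilted fun x => -V x)) ^ 2)) / (1 - η)) *
        ∫ x in K, exp (-(V x + ∑ k, q k * ⟪u k, x⟫ ^ 2)) := by
  have hg0 : ∀ x : EuclideanSpace ℝ (Fin n), 0 ≤ ∑ k, q k * ⟪u k, x⟫ ^ 2 :=
    fun x => Finset.sum_nonneg fun k _ => mul_nonneg (hq k) (sq_nonneg _)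
  have hgc : Continuous fun x : EuclideanSpace ℝ (Fin n) => ∑ k, q k * ⟪u k, x⟫ ^ 2 :=
    continuous_finsetSum _ fun k _ => continuous_const.mul ((continuous_const.inner continuous_id).pow 2)
  have eρ : ∀ x : EuclideanSpace ℝ (Fin n),
      exp (-(V x + ∑ k, q k * ⟪u k, x⟫ ^ 2)) * exp (∑ k, q k * ⟪u k, x⟫ ^ 2) = exp (-V x) := fun x => by
    rw [← exp_add]; ring_nf
  have hρi : Integrable fun x : EuclideanSpace ℝ (Fin n) => exp (-(V x + ∑ k, q k * ⟪u k, x⟫ ^ 2)) :=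
    hZ.mono' (hVc.add hgc).neg.rexp.aestronglyMeasurable (ae_of_all _ fun x => by
      rw [Real.norm_of_nonneg (exp_pos _).le]
      exact exp_le_exp.2 (by linarith [hg0 x]))
  have h2v : ∀ k, Integrable (fun x : EuclideanSpace ℝ (Fin n) => exp (-V x) * ⟪u k, x⟫ ^ 2) := fun k => by
    have := (integrable_tilted_iff hZ _).1 (h2 k)
    simpa only [smul_eq_mul] using this
  have hgiV : Integrable fun x : EuclideanSpace ℝ (Fin n) => (∑ k, q k * ⟪u k, x⟫ ^ 2) * exp (-V x) := by
    have hsum := integrable_finsetSum Finset.univ fun k _ => (h2v k).const_mul (q k)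
    refine hsum.congr (ae_of_all _ fun x => ?_)
    simp only [Finset.sum_mul]
    exact Finset.sum_congr rfl fun k _ => by ring
  -- positivity of the masses
  have hZpos : 0 < ∫ x, exp (-V x) := integral_exp_pos hZ
  have h1η : 0 < 1 - η := sub_pos.2 hη
  have hKpos : 0 < ∫ x in K, exp (-V x) := lt_of_lt_of_le (mul_pos h1η hZpos) hmass
  -- the Jensen step under the WINDOWED weight
  have hZ'K : Integrable (fun x : EuclideanSpace ℝ (Fin n) =>
      exp (-(V x + ∑ k, q k * ⟪u k, x⟫ ^ 2)) * exp (∑ k, q k * ⟪u k, x⟫ ^ 2)) (volume.restrict K) := by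
    simp_rw [eρ]; exact hZ.restrict
  have hgiK : Integrable (fun x : EuclideanSpace ℝ (Fin n) =>
      (∑ k, q k * ⟪u k, x⟫ ^ 2) * (exp (-(V x + ∑ k, q k * ⟪u k, x⟫ ^ 2)) * exp (∑ k, q k * ⟪u k, x⟫ ^ 2)))
      (volume.restrict K) := by
    simp_rw [eρ]; exact hgiV.restrict
  have hposK : 0 < ∫ x in K, exp (-(V x + ∑ k, q k * ⟪u k, x⟫ ^ 2)) * exp (∑ k, q k * ⟪u k, x⟫ ^ 2) := by
    simp_rw [eρ]; exact hKpos
  have key := integral_mul_exp_le_exp_tiltedMean (volume.restrict K) (fun x => (exp_pos _).le) hρi.restrict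
    hZ'K hgiK hposK
  simp_rw [eρ] at key
  refine key.trans (mul_le_mul_of_nonneg_right (exp_le_exp.2 ?_) (integral_nonneg fun x => (exp_pos _).le))
  -- windowed tilted mean ≤ unwindowed tilted mean ∕ (1 − η)
  have hnum : ∫ x in K, (∑ k, q k * ⟪u k, x⟫ ^ 2) * exp (-V x) ≤ ∫ x, (∑ k, q k * ⟪u k, x⟫ ^ 2) * exp (-V x) :=
    setIntegral_le_integral hgiV (ae_of_all _ fun x => mul_nonneg (hg0 x) (exp_pos _).le)
  have hnum0 : 0 ≤ ∫ x, (∑ k, q k * ⟪u k, x⟫ ^ 2) * exp (-V x) :=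
    integral_nonneg fun x => mul_nonneg (hg0 x) (exp_pos _).le
  have htilt : (∫ x : EuclideanSpace ℝ (Fin n), (∑ k, q k * ⟪u k, x⟫ ^ 2) * exp (-V x)) / ∫ x, exp (-V x) =
      ∫ x, ∑ k, q k * ⟪u k, x⟫ ^ 2 ∂(volume.tilted fun x => -V x) := by
    rw [integral_tilted, ← integral_div]
    refine integral_congr_ae (ae_of_all _ fun x => ?_)
    simp only [smul_eq_mul]
    ring
  calc (∫ x in K, (∑ k, q k * ⟪u k, x⟫ ^ 2) * exp (-V x)) / ∫ x in K, exp (-V x)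
      ≤ (∫ x, (∑ k, q k * ⟪u k, x⟫ ^ 2) * exp (-V x)) / ((1 - η) * ∫ x, exp (-V x)) :=
        div_le_div₀ hnum0 hnum (mul_pos h1η hZpos) hmass
    _ = ((∫ x, (∑ k, q k * ⟪u k, x⟫ ^ 2) * exp (-V x)) / ∫ x, exp (-V x)) / (1 - η) := by
        rw [div_div, mul_comm]
    _ ≤ (∑ k, q k * (lam⁻¹ * ‖u k‖ ^ 2 + (∫ x, ⟪u k, x⟫ ∂(volume.tilted fun x => -V x)) ^ 2)) / (1 - η) := by
        rw [htilt]
        exact div_le_div_of_nonneg_right (tiltedMean_qf_le hlam hVc hV hZ q hq u h1 h2) h1η.le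

end Euclidean

end Summit.QuantumFields.BalabanUV.T4Continuum.NE7b.ConvexTiltMoment

end
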